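import Summits.FinalStateConjecture.FinalStateConjecture.Theorems.EIHFluxBalanceInertialRecessionStubEndgameOracleMixed

/-!
# Route EIHFluxBalance — crux `InertialRecession`, line `sublinear-is-free-clean-window-charges`:
# the increment oracle for a tight PIECE with mixed outsiders (`tight_increment_mixed`)

Helper file for the crux `stmt-FinalStateConjecture-10166`
(`Summit.FinalStateConjecture.FinalStateConjecture.Theses.EIHFluxBalance.InertialRecession`), registered stub `stub_incrementOracle`
(lead reshape r9/r10) of `Cruxes/InertialRecession/Lines/sublinear_is_free_clean_window_charges.lean`; continues `…OracleMixed`.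

`tight_increment_mixed`: the analogue of `tight_increment` (`…OracleTightIncrement`) when the non-members of the piece `S` split into
ballistic outsiders `B` (floor `W/2`, distance `≥ A₀`) and far pieces `F` (distance `≥ λs`): with the explicit radius
`R = min(c₀s, (2/3)·min_{j∉S}‖ξⱼ − ξₐ‖)` (2-Lipschitz), tightness `‖ξᵢ − ξₐ‖ ≤ R/2` on `S` and `ρ ≤ R/2`,
`|ΔE_S|, |ΔΠ_S^k| ≤ C·(2c₀^{-3/2}t₁^{-1/2} + |B|·2·2√2·8/(W√A₀) + |F|·2·2λ^{-3/2}t₁^{-1/2}) + ζ(t₁) + ζ(t₂)`.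
-/

noncomputable section

set_option linter.dupNamespace false

open Filter Topology Set MeasureTheory intervalIntegral
open scoped Topology BigOperators InnerProductSpace RealInnerProductSpace

namespace Summit.FinalStateConjecture.FinalStateConjecture.Theorems.SublinearIsFree.Oracle

open Literature.Geometry.Lorentzian
open Summit.FinalStateConjecture.FinalStateConjecture.Theorems.SublinearIsFree.Endgame
open Summit.FinalStateConjecture.FinalStateConjecture.Theorems.SublinearIsFree.Toy

set_option maxHeartbeats 800000 in
/-- **THE INCREMENT ORACLE FOR A TIGHT PIECE WITH MIXED OUTSIDERS.** See the module docstring. [folklore] -/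
theorem tight_increment_mixed {N : ℕ} (M : Fin N → ℝ) (ξ v : Fin N → ℝ → E3) (κ : ℝ) (P : ℝ → E3 → ℝ → Fin 4 → ℝ)
    (ρ : ℝ → ℝ) (C T T' T₀ : ℝ) (ζ : ℝ → ℝ)
    (hWL : ∀ (t₁ t₂ : ℝ) (c : ℝ → E3) (R : ℝ → ℝ), T ≤ t₁ → t₁ ≤ t₂ →
      (∀ s ∈ Set.Icc t₁ t₂, ∀ s' ∈ Set.Icc t₁ t₂, ‖c s - c s'‖ ≤ 2 * |s - s'| ∧ |R s - R s'| ≤ 2 * |s - s'|) →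
      (∀ s ∈ Set.Icc t₁ t₂, ρ s ≤ (1 / 2) * R s ∧ ‖c s‖ + R s ≤ (κ + κ ^ 2) / 2 * s ∧
        ∀ j, ‖ξ j s - c s‖ ≤ (1 - 1 / 2) * R s ∨ (1 + 1 / 2) * R s ≤ ‖ξ j s - c s‖) →
      ∀ μ : Fin 4, |P t₂ (c t₂) (R t₂) μ - P t₁ (c t₁) (R t₁) μ| ≤ C * ∫ s in t₁..t₂, (R s ^ (3 / 2 : ℝ))⁻¹)
    (hID : ∀ (t : ℝ) (c : E3) (R : ℝ) (A : Finset (Fin N)), T' ≤ t → ρ t ≤ (1 / 2) * R →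
      ‖c‖ + R ≤ (κ + κ ^ 2) / 2 * t →
      (∀ j, ‖ξ j t - c‖ ≤ (1 - 1 / 2) * R ∨ (1 + 1 / 2) * R ≤ ‖ξ j t - c‖) →
      (∀ j, j ∈ A ↔ ‖ξ j t - c‖ ≤ (1 - 1 / 2) * R) →
      |P t c R 0 - ∑ j ∈ A, M j * (√(1 - ‖v j t‖ ^ 2))⁻¹| ≤ ζ t ∧
      ∀ k : Fin 3, |P t c R k.succ - ∑ j ∈ A, M j * (√(1 - ‖v j t‖ ^ 2))⁻¹ * v j t k| ≤ ζ t)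
    (hC : 0 ≤ C) (hκ0 : 0 < κ) (hκ1 : κ < 1)
    (hξ : ∀ i, ContDiff ℝ 1 (ξ i)) (hspeed1 : ∀ i s, T₀ ≤ s → ‖deriv (ξ i) s‖ ≤ 1)
    {S B F : Finset (Fin N)} {a : Fin N} (hSc : (Finset.univ \ S).Nonempty) (hBF : ∀ j ∈ Finset.univ \ S, j ∈ B ∨ j ∈ F)
    {t₁ t₂ W A₀ lam : ℝ} (hT : T ≤ t₁) (hT' : T' ≤ t₁) (hT₀ : T₀ ≤ t₁) (ht₁ : 0 < t₁) (h12 : t₁ ≤ t₂)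
    (hW : 0 < W) (hA₀ : 0 < A₀) (hlam : 0 < lam)
    (hcone : ∀ s ∈ Set.Icc t₁ t₂, ‖ξ a s‖ ≤ κ ^ 2 * s)
    (n : Fin N → E3) (hn : ∀ j ∈ B, ‖n j‖ = 1)
    (hball : ∀ j ∈ B, ∀ s ∈ Icc t₁ t₂, W / 2 ≤ ⟪deriv (ξ j) s - deriv (ξ a) s, n j⟫)
    (hfarB : ∀ j ∈ B, ∀ s ∈ Icc t₁ t₂, A₀ ≤ ‖ξ j s - ξ a s‖)
    (hfarF : ∀ j ∈ F, ∀ s ∈ Icc t₁ t₂, lam * s ≤ ‖ξ j s - ξ a s‖)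
    (hρ : ∀ s ∈ Set.Icc t₁ t₂,
      ρ s ≤ min ((κ - κ ^ 2) / 2 * s) (2 / 3 * (Finset.univ \ S).inf' hSc fun j ↦ ‖ξ j s - ξ a s‖) / 2)
    (htight : ∀ s ∈ Set.Icc t₁ t₂, ∀ i ∈ S,
      ‖ξ i s - ξ a s‖ ≤ min ((κ - κ ^ 2) / 2 * s) (2 / 3 * (Finset.univ \ S).inf' hSc fun j ↦ ‖ξ j s - ξ a s‖) / 2) :
    |∑ j ∈ S, M j * (√(1 - ‖v j t₂‖ ^ 2))⁻¹ - ∑ j ∈ S, M j * (√(1 - ‖v j t₁‖ ^ 2))⁻¹| ≤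
        C * (2 * (((κ - κ ^ 2) / 2) ^ (3 / 2 : ℝ))⁻¹ * (t₁ ^ (1 / 2 : ℝ))⁻¹ +
          B.card * (2 * (2 * √2 * (8 / (W * √A₀)))) + F.card * (2 * (2 * (lam ^ (3 / 2 : ℝ))⁻¹ * (t₁ ^ (1 / 2 : ℝ))⁻¹))) +
          ζ t₁ + ζ t₂ ∧
    ∀ k : Fin 3, |∑ j ∈ S, M j * (√(1 - ‖v j t₂‖ ^ 2))⁻¹ * v j t₂ k - ∑ j ∈ S, M j * (√(1 - ‖v j t₁‖ ^ 2))⁻¹ * v j t₁ k| ≤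
        C * (2 * (((κ - κ ^ 2) / 2) ^ (3 / 2 : ℝ))⁻¹ * (t₁ ^ (1 / 2 : ℝ))⁻¹ +
          B.card * (2 * (2 * √2 * (8 / (W * √A₀)))) + F.card * (2 * (2 * (lam ^ (3 / 2 : ℝ))⁻¹ * (t₁ ^ (1 / 2 : ℝ))⁻¹))) +
          ζ t₁ + ζ t₂ := by
  classical
  set c₀ : ℝ := (κ - κ ^ 2) / 2 with hc₀def
  have hκκ : 0 < κ - κ ^ 2 := by nlinarith
  have hc₀ : 0 < c₀ := by positivity
  set Sc := Finset.univ \ S with hScdef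
  set D : ℝ → ℝ := fun s ↦ Sc.inf' hSc fun j ↦ ‖ξ j s - ξ a s‖ with hD
  set R : ℝ → ℝ := fun s ↦ min (c₀ * s) (2 / 3 * D s) with hR
  have hdiff : ∀ i, Differentiable ℝ (ξ i) := fun i ↦ (hξ i).differentiable one_ne_zero
  have hmemSc : ∀ j, j ∈ Sc ↔ j ∉ S := fun j ↦ by simp [hScdef]
  have hDpos : ∀ s ∈ Set.Icc t₁ t₂, 0 < D s := by
    intro s hs
    obtain ⟨j, hj, hjmin⟩ := Finset.exists_mem_eq_inf' hSc (fun j ↦ ‖ξ j s - ξ a s‖)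
    simp only [hD]; rw [hjmin]
    rcases hBF j hj with h | h
    · exact hA₀.trans_le (hfarB j h s hs)
    · exact (mul_pos hlam (ht₁.trans_le hs.1)).trans_le (hfarF j h s hs)
  have hRpos : ∀ s ∈ Set.Icc t₁ t₂, 0 < R s := fun s hs ↦
    lt_min (mul_pos hc₀ (ht₁.trans_le hs.1)) (by have := hDpos s hs; positivity)
  have hRlip : ∀ s ∈ Set.Icc t₁ t₂, ∀ s' ∈ Set.Icc t₁ t₂, |R s - R s'| ≤ 2 * |s - s'| := by
    intro s hs s' hs'
    have hDlip : |D s - D s'| ≤ 2 * |s - s'| :=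
      abs_inf'_sub_inf'_le Sc hSc (fun j σ ↦ ‖ξ j σ - ξ a σ‖) fun j _ ↦
        abs_dist_sub_dist_le_two (hdiff j) (hdiff a) (fun t ht ↦ hspeed1 j t ht) (fun t ht ↦ hspeed1 a t ht)
          (hT₀.trans hs.1) (hT₀.trans hs'.1)
    have h1 : |c₀ * s - c₀ * s'| ≤ 2 * |s - s'| := by
      rw [← mul_sub, abs_mul, abs_of_pos hc₀]
      have hc₀1 : c₀ ≤ 1 := by rw [hc₀def]; nlinarith
      have := abs_nonneg (s - s')
      nlinarith
    have h2 : |2 / 3 * D s - 2 / 3 * D s'| ≤ 2 * |s - s'| := by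
      rw [← mul_sub, abs_mul, abs_of_pos (by norm_num : (0 : ℝ) < 2 / 3)]
      have := abs_nonneg (s - s')
      nlinarith
    calc |R s - R s'| ≤ max |c₀ * s - c₀ * s'| |2 / 3 * D s - 2 / 3 * D s'| := abs_min_sub_min_le _ _ _ _
      _ ≤ 2 * |s - s'| := max_le h1 h2
  have hcap : ∀ s ∈ Set.Icc t₁ t₂, ‖ξ a s‖ + R s ≤ (κ + κ ^ 2) / 2 * s := by
    intro s hs
    have h1 : R s ≤ c₀ * s := min_le_left _ _
    have h2 := hcone s hs
    have : κ ^ 2 * s + c₀ * s = (κ + κ ^ 2) / 2 * s := by rw [hc₀def]; ring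
    linarith
  have hnon : ∀ s ∈ Set.Icc t₁ t₂, ∀ j ∉ S, 3 * R s / 2 ≤ ‖ξ j s - ξ a s‖ := by
    intro s hs j hj
    have hj' : j ∈ Sc := (hmemSc j).mpr hj
    have h1 : R s ≤ 2 / 3 * D s := min_le_right _ _
    have h2 : D s ≤ ‖ξ j s - ξ a s‖ := Finset.inf'_le _ hj'
    linarith
  have hinc := increment_of_windowPath M ξ v κ P ρ C T T' T₀ ζ hWL hID hdiff
    (fun i s hs ↦ (hspeed1 i s hs).trans (by norm_num)) hT hT' hT₀ h12 hRlip hRpos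
    (fun s hs ↦ by simpa [hR, hD, hc₀def] using hρ s hs) hcap
    (fun s hs i hi ↦ by simpa [hR, hD, hc₀def] using htight s hs i hi) hnon (A := S) (a := a)
  have hint := integral_radius_le_mixed ξ hξ Sc B F hSc hBF a ht₁ h12 hc₀ hW hA₀ hlam n hn hball hfarB hfarF
  have hbound := mul_le_mul_of_nonneg_left hint hC
  exact ⟨hinc.1.trans (by linarith), fun k ↦ (hinc.2 k).trans (by linarith)⟩

/-- Registered helper form: scaling a distance lower bound — if `λs ≤ d` with `λ, s > 0` then `(d√d)⁻¹ ≤ ((λs)√(λs))⁻¹` (carrier of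
this file). [folklore] -/
theorem oracle_inv_mul_sqrt_antitone : ∀ (lam s d : ℝ), 0 < lam → 0 < s → lam * s ≤ d →
    (d * √d)⁻¹ ≤ (lam * s * √(lam * s))⁻¹ := by
  intro lam s d hlam hs hd
  have hls : 0 < lam * s := mul_pos hlam hs
  have hd0 : 0 < d := hls.trans_le hd
  refine inv_anti₀ (by positivity) ?_
  exact mul_le_mul hd (Real.sqrt_le_sqrt hd) (Real.sqrt_nonneg _) hd0.le

end Summit.FinalStateConjecture.FinalStateConjecture.Theorems.SublinearIsFree.Oracle

end
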